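import Summits.HodgeConjecture.CorCM.MultiFieldWeilNonIsomorphicDecicFamilies
import Summits.HodgeConjecture.CorCM.MultiFieldWeilCrossDegreeMovers
import HarnessLib

/-!
# MULTI-FIELD WEIL ENGINE — THE INTRINSIC SEXTIC + DECIC HEADLINE: any number of `(1,2)`-threefolds over SEXTIC CM fields through `k` and of
# `(2,3)`-fivefolds over DECIC CM fields through `k`, `Hom = ∅` asked WITHIN EACH DEGREE ONLY — the Hodge conjecture for every product of copies,
# given only Markman's fourfold and hyperbolic-sixfold theorems

Cell `pub-hodgecm2` (COR-CM), seat b30 gen 38 (2026-08-25); count-neutral own lane MULTI-FIELD WEIL ENGINE (stem `MultiFieldWeil*`), the consumer of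
`CorCM/MultiFieldWeilPrimeDegreesOutsideClosures.lean` (W1: same prime size — one value outside a Galois closure; §3 sextic `Hom = ∅`),
`CorCM/MultiFieldWeilNonIsomorphicDecicFamilies.lean` (Y1: decic `Hom = ∅`, Dodson's bound) and `CorCM/MultiFieldWeilCrossDegreeMovers.lean` (Y2: sizes `5` and `3` —
stabiliser-transitivity with NO hypothesis, Jordan + simplicity of `𝔄₅`).  Theorems only; no definition, no named fact, no `sorry`.  HONEST FRAMING: conditional ONLY on
the two displayed binders `Markman2025_weilClasses_algebraic_abelianFourfold` (sextic slots) and `Markman2025_weilClasses_algebraic_hyperbolicSixfold` (decic slots);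
`HC_CM` is NOT proved and not asserted.

§1 **THE `hST` BINDER OF V2, PAIR BY PAIR** (`stabiliserTransitive_of_sexticsDecics_of_outside_sameDegree`).  Slots of relative degrees `n_m ∈ {3, 5}` over the
imaginary quadratic `k`; for two slots of the SAME degree some `τ`-embedding of the one field takes a value outside the Galois closure of the other (`hout`, asked
only when `n_{m₀} = n_m`).  Then for ALL `m₀ ≠ m` and all `τ`-embeddings `s, s'` of `K_m` an automorphism of `ℂ` over `τ(k)` fixes every `τ`-embedding of `K_{m₀}`
and carries `s` to `s'`: same degree by W1 `exists_aut_fix_comp_eq_of_outside_prime`, degrees `{3, 5}` by Y2 `exists_aut_fix_comp_eq_of_sizes_three_five` (free).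
`exists_outside_of_isEmpty_ringHom_sameDegree`: `hout` from `Hom(K_m, K_{m₀}) = ∅` (W1 §3 for sextics, Y1 §1 for decics).

§2 **HEADLINE `hodgeConjectureFor_biproduct_comp_of_sexticsDecics_of_isEmpty_ringHom`.**  `k = Kf i₀` imaginary quadratic, `E = A 0 ⊨ (k; {τ})`; `B_m = A (m+1) ⊨
(K_m; Φ (m+1))` over CM fields `K_m ⊇ i_m(k)` with `([K_m : k], #(Φ (m+1) over τ)) ∈ {(3,1), (5,2)}` — simple CM THREEFOLDS over sextic fields and Weil-type CM
FIVEFOLDS over decic fields, any number of each, in any order; HYPOTHESIS: `Hom(K_m, K_{m₀}) = ∅` whenever `m₀ ≠ m` have `[K_{m₀} : k] = [K_m : k]` (pairwise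
non-isomorphic sextics, pairwise non-isomorphic decics; NOTHING across the two degrees).  Then the Hodge conjecture holds for EVERY product of copies
`E^a × ∏ T_m^{b_m} × ∏ F_m^{c_m}` (`hodgeConjectureFor_biproduct_comp_of_sexticsDecics_of_stabiliserTransitive` of V2 with §1), and for everything such a product
dominates.  This is W1's `hodgeConjectureFor_biproduct_comp_of_sexticsDecics_of_outside_closures` with its closure hypothesis DISCHARGED: within a degree by
`Hom = ∅`, across degrees by group theory.  It contains W1 §3 (sextics only, mod Markman 4), Y1 §2 (decics only, mod Markman 6), gen 32's four-field theorem
`hodgeConjectureFor_biproduct_comp_of_two_sextics_two_decics_of_isEmpty` and gen 27's `E × T × F`.  (Example: `k = ℚ(i)`, `T_j` over `k·C_j` for the cubic fields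
`C_j ⊂ ℚ(ζ₇), ℚ(ζ₉), ℚ(ζ₁₃)`, `F_j` over `k·Q_j` for non-isomorphic totally real quintics `Q_j` — every product of copies of `E, T₁, T₂, T₃, F₁, F₂, …`.)
NOT covered, honestly: two non-isogenous factors over ISOMORPHIC fields of one degree (sextic twins: the `MultiFieldWeilTwin*` files; decic: `DecicWeil23*`), octic
slots (size `4` is not prime: the cross-degree statement of Y2 is false for `3` and `4`, e.g. `k·C` with `𝔖₃`-cubic `C` and the biquadratic `k·ℚ(√disc C, √b)`).

[cite: Markman2025SurveySecant, Thm. 1.2] [cite: Markman2025SecantWeil, Thm 1.5.1] [cite: Pohlmann1968, Thm 1] [cite: MoonenZarhin1995Duke, Thm. 2.4]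
[cite: Dodson1984, §1.1 Imprimitivity Theorem and §5.1.2 Theorem] [cite: DixonMortimer1996, §1.6, Thm. 1.6A; §3.3, Thm. 3.3A] [cite: Lang2002, I §5 Thm. 5.5, VI §1 Thm. 1.1 and Cor. 1.6]
[cite: Shimura1998, §18.2 Lemma (i)] [cite: MumfordAV1970, §19]

## References
* [Markman2025SurveySecant] E. Markman, arXiv:2509.23403, Thm. 1.2 (the fourfold theorem, displayed binder).  [Markman2025SecantWeil] E. Markman, Cycles on abelian 2n-folds
  of Weil type from secant sheaves on abelian n-folds, Thm 1.5.1 (the hyperbolic-sixfold theorem, displayed binder).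
* [Pohlmann1968] H. Pohlmann, Ann. of Math. 88 (1968), Thm 1.  [MoonenZarhin1995Duke] B. Moonen, Yu. Zarhin, Duke Math. J. 77 (1995), Thm. 2.4.  [Dodson1984] B. Dodson,
  Trans. AMS 283 (1984), §1.1, §5.1.2.  [DixonMortimer1996] J. D. Dixon, B. Mortimer, *Permutation Groups*, GTM 163, §1.6, §3.3.  [Lang2002] S. Lang, *Algebra*, GTM 211,
  I §5, VI §1.  [Shimura1998] G. Shimura, *Abelian varieties with complex multiplication and modular functions*, §18.2.  [MumfordAV1970] D. Mumford, *Abelian Varieties*, §19.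
-/

noncomputable section

open CategoryTheory CategoryTheory.Limits NumberField IntermediateField

namespace Summit.HodgeConjecture.CorCM.MultiFieldWeil

open Finset
open Literature.AlgebraicGeometry Literature.AlgebraicGeometry.Motives Literature.AlgebraicGeometry.HodgeTheory
open Literature.AlgebraicGeometry.ComplexMultiplication (IsCMTypeRealisation)
open Literature.AlgebraicTopology.SingularHomology
open Literature.NumberTheory.ComplexMultiplication
open Summit.HodgeConjecture.CorCM.Census.MultiFieldWeil

open scoped Classical

/-! ## §1 The `hST` binder pair by pair: same degree from `hout` ∕ `Hom = ∅`, degrees `3` and `5` for free -/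

section Binder

variable {I : Type} {r : ℕ} {Kf : I → Type} [∀ i, Field (Kf i)] [∀ i, NumberField (Kf i)] [∀ i, IsCMField (Kf i)]
  {i₀ : I} {is : Fin r → I} {n : Fin r → ℕ} {τ : Kf i₀ →+* ℂ}

/-- Two slots of relative degrees in `{3, 5}` have equal degrees or degrees `{3, 5}`. [folklore] -/
theorem sizes_three_five_of_ne (hn : ∀ m, n m = 3 ∨ n m = 5) {m₀ m : Fin r} (heq : n m₀ ≠ n m) : (n m₀ = 5 ∧ n m = 3) ∨ (n m₀ = 3 ∧ n m = 5) := by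
  rcases hn m₀ with h₀ | h₀ <;> rcases hn m with h | h
  · exact absurd (h₀.trans h.symm) heq
  · exact Or.inr ⟨h₀, h⟩
  · exact Or.inl ⟨h₀, h⟩
  · exact absurd (h₀.trans h.symm) heq

/-- **THE `hST` BINDER FOR SEXTIC AND DECIC SLOTS, PAIR BY PAIR.**  `k = Kf i₀` imaginary quadratic, `[K_l : ℚ] = 2 n_l` along `i_l`, `n_l ∈ {3, 5}`; for `m₀ ≠ m` of the
SAME relative degree some `τ`-embedding of `K_m` takes some value outside `L(K_{m₀})`.  Then for ALL `m₀ ≠ m` and all `τ`-embeddings `s, s'` of `K_m` an automorphism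
of `ℂ` over `τ(k)` fixes every `τ`-embedding of `K_{m₀}` and carries `s` to `s'` (same degree: W1; degrees `3` and `5`: Y2, no hypothesis). [cite: DixonMortimer1996, §1.6, Thm. 1.6A; §3.3, Thm. 3.3A]
[cite: Shimura1998, §18.2 Lemma (i)] [cite: Lang2002, I §5 Thm. 5.5 and VI §1 Cor. 1.6] -/
theorem stabiliserTransitive_of_sexticsDecics_of_outside_sameDegree (h2 : Module.finrank ℚ (Kf i₀) = 2)
    (hdeg : ∀ l : Fin r, Module.finrank ℚ (Kf (is l)) = 2 * n l) (im : ∀ l : Fin r, Kf i₀ →+* Kf (is l)) (hn : ∀ m, n m = 3 ∨ n m = 5)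
    (hout : ∀ (m₀ m : Fin r), m₀ ≠ m → n m₀ = n m → ∃ s : Kf (is m) →+* ℂ, s.comp (im m) = τ ∧ ∃ x, s x ∉ normalClosure ℚ (Kf (is m₀)) ℂ)
    (m₀ m : Fin r) (hm : m₀ ≠ m) (s s' : Kf (is m) →+* ℂ) (hs : s.comp (im m) = τ) (hs' : s'.comp (im m) = τ) :
    ∃ ρ : ℂ ≃+* ℂ, (ρ : ℂ →+* ℂ).comp τ = τ ∧ (∀ u : Kf (is m₀) →+* ℂ, u.comp (im m₀) = τ → (ρ : ℂ →+* ℂ).comp u = u) ∧ (ρ : ℂ →+* ℂ).comp s = s' := by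
  by_cases heq : n m₀ = n m
  · exact exists_aut_fix_comp_eq_of_outside_prime h2 hdeg im m₀ m (by rcases hn m with h | h <;> rw [h] <;> norm_num) (hout m₀ m hm heq) s s' hs hs'
  · exact exists_aut_fix_comp_eq_of_sizes_three_five h2 hdeg im m₀ m (sizes_three_five_of_ne hn heq) s s' hs hs'

/-- **`hout` within a degree from `Hom = ∅`**: `n_l ∈ {3, 5}`; for `m₀ ≠ m` of the same relative degree and `Hom(K_m, K_{m₀}) = ∅`, some (indeed every) `τ`-embedding
of `K_m` takes a value outside `L(K_{m₀})` (sextic: W1 `exists_apply_not_mem_normalClosure_of_isEmpty_ringHom`, degrees `18 ∤ 12`; decic: Y1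
`exists_apply_not_mem_normalClosure_of_isEmpty_ringHom_five`, `25 ∤ 3840`). [cite: Dodson1984, §1.1 Imprimitivity Theorem and §5.1.2 Theorem] [cite: Lang2002, VI §1 Thm. 1.1] -/
theorem exists_outside_of_isEmpty_ringHom_sameDegree (h2 : Module.finrank ℚ (Kf i₀) = 2) (hdeg : ∀ l : Fin r, Module.finrank ℚ (Kf (is l)) = 2 * n l)
    (im : ∀ l : Fin r, Kf i₀ →+* Kf (is l)) (hn : ∀ m, n m = 3 ∨ n m = 5)
    (hiso : ∀ (m₀ m : Fin r), m₀ ≠ m → n m₀ = n m → IsEmpty (Kf (is m) →+* Kf (is m₀))) (m₀ m : Fin r) (hm : m₀ ≠ m) (heq : n m₀ = n m) :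
    ∃ s : Kf (is m) →+* ℂ, s.comp (im m) = τ ∧ ∃ x, s x ∉ normalClosure ℚ (Kf (is m₀)) ℂ := by
  have hc := SexticOcticWeil.card_filter_comp_eq_of_finrank (n := n m) (im m) (hdeg m) h2 τ
  obtain ⟨s, hs⟩ := Finset.card_pos.1 (by rw [hc]; rcases hn m with h | h <;> rw [h] <;> norm_num)
  have hs' : s.comp (im m) = τ := (Finset.mem_filter.1 hs).2
  refine ⟨s, hs', ?_⟩
  rcases hn m with h3 | h5
  · exact exists_apply_not_mem_normalClosure_of_isEmpty_ringHom h2 im (by rw [hdeg m₀, heq, h3]) (by rw [hdeg m, h3]) (hiso m₀ m hm heq) s hs'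
  · exact exists_apply_not_mem_normalClosure_of_isEmpty_ringHom_five h2 im (by rw [hdeg m₀, heq, h5]) (by rw [hdeg m, h5]) (hiso m₀ m hm heq) s hs'

/-- **THE `hST` BINDER FROM `Hom = ∅` WITHIN EACH DEGREE** (sextic and decic slots; nothing across degrees). [cite: Dodson1984, §1.1 Imprimitivity Theorem and §5.1.2 Theorem]
[cite: DixonMortimer1996, §3.3, Thm. 3.3A] [cite: Shimura1998, §18.2 Lemma (i)] -/
theorem stabiliserTransitive_of_sexticsDecics_of_isEmpty_ringHom (h2 : Module.finrank ℚ (Kf i₀) = 2)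
    (hdeg : ∀ l : Fin r, Module.finrank ℚ (Kf (is l)) = 2 * n l) (im : ∀ l : Fin r, Kf i₀ →+* Kf (is l)) (hn : ∀ m, n m = 3 ∨ n m = 5)
    (hiso : ∀ (m₀ m : Fin r), m₀ ≠ m → n m₀ = n m → IsEmpty (Kf (is m) →+* Kf (is m₀)))
    (m₀ m : Fin r) (hm : m₀ ≠ m) (s s' : Kf (is m) →+* ℂ) (hs : s.comp (im m) = τ) (hs' : s'.comp (im m) = τ) :
    ∃ ρ : ℂ ≃+* ℂ, (ρ : ℂ →+* ℂ).comp τ = τ ∧ (∀ u : Kf (is m₀) →+* ℂ, u.comp (im m₀) = τ → (ρ : ℂ →+* ℂ).comp u = u) ∧ (ρ : ℂ →+* ℂ).comp s = s' :=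
  stabiliserTransitive_of_sexticsDecics_of_outside_sameDegree h2 hdeg im hn (exists_outside_of_isEmpty_ringHom_sameDegree h2 hdeg im hn hiso) m₀ m hm s s' hs hs'

end Binder

/-! ## §2 The headline -/

section Headline

variable {I : Type} {r : ℕ} {Kf : I → Type} [∀ i, Field (Kf i)] [∀ i, NumberField (Kf i)] [∀ i, IsCMField (Kf i)]
  {i₀ : I} {is : Fin r → I} {τ : Kf i₀ →+* ℂ}
  {A : Fin (r + 1) → AbelianVariety ℂ} {Φ : ∀ j : Fin (r + 1), CMType (Kf (mfSlots i₀ is j))}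
  {ι : ∀ j, 𝓞 (Kf (mfSlots i₀ is j)) →+* End (A j)}
  {θ : ∀ j, Kf (mfSlots i₀ is j) →+* Module.End ℂ (complexBetti (A j).X 1)}

/-- **HEADLINE — ANY NUMBER OF SEXTIC `(1,2)` AND DECIC `(2,3)` CM FIELDS THROUGH `k`, A VALUE OUTSIDE THE CLOSURE ASKED ONLY BETWEEN FIELDS OF THE SAME DEGREE, GIVEN
ONLY MARKMAN'S TWO THEOREMS.**  `k = Kf i₀` imaginary quadratic, `E = A 0 ⊨ (k; {τ})`, `B_m = A (m+1) ⊨ (K_m; Φ (m+1))`, `[K_m : ℚ] = 2 n_m` with `(n_m, p_m) ∈ {(3,1), (5,2)}`;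
for `m₀ ≠ m` with `n_{m₀} = n_m` some `τ`-embedding of `K_m` takes some value outside `L(K_{m₀})` — nothing is asked when `n_{m₀} ≠ n_m`.  Then the Hodge conjecture holds
for EVERY product of copies `⨁_j A(κ j)`.  `HC_CM` is NOT asserted. [cite: Markman2025SurveySecant, Thm. 1.2] [cite: Markman2025SecantWeil, Thm 1.5.1] [cite: Pohlmann1968, Thm 1]
[cite: MoonenZarhin1995Duke, Thm. 2.4] [cite: DixonMortimer1996, §1.6, Thm. 1.6A; §3.3, Thm. 3.3A] -/
theorem hodgeConjectureFor_biproduct_comp_of_sexticsDecics_of_outside_sameDegree (hW4 : Markman2025_weilClasses_algebraic_abelianFourfold)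
    (hM6 : Markman2025_weilClasses_algebraic_hyperbolicSixfold) (n p : Fin r → ℕ) (hnp : ∀ m, (n m = 3 ∧ p m = 1) ∨ (n m = 5 ∧ p m = 2))
    {N : ℕ} (κ : Fin N → Fin (r + 1)) (h2 : Module.finrank ℚ (Kf i₀) = 2) (hdeg : ∀ m : Fin r, Module.finrank ℚ (Kf (is m)) = 2 * n m)
    (im : ∀ m : Fin r, Kf i₀ →+* Kf (is m)) (hA : ∀ j, IsCMTypeRealisation (Φ j) (A j) (ι j) (θ j)) (hΨ : ∀ σ : Kf i₀ →+* ℂ, σ ∈ (Φ 0).1 ↔ σ = τ)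
    (hp : ∀ m : Fin r, (Finset.univ.filter fun s : Kf (is m) →+* ℂ => s.comp (im m) = τ ∧ s ∈ (Φ m.succ).1).card = p m)
    (hout : ∀ (m₀ m : Fin r), m₀ ≠ m → n m₀ = n m → ∃ s : Kf (is m) →+* ℂ, s.comp (im m) = τ ∧ ∃ x, s x ∉ normalClosure ℚ (Kf (is m₀)) ℂ) :
    HodgeConjectureFor (⨁ fun j => A (κ j)).dim (⨁ fun j => A (κ j)).X :=
  hodgeConjectureFor_biproduct_comp_of_sexticsDecics_of_stabiliserTransitive hW4 hM6 n p hnp κ h2 hdeg im hA hΨ hp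
    (stabiliserTransitive_of_sexticsDecics_of_outside_sameDegree h2 hdeg im (fun m => (hnp m).imp And.left And.left) hout)

/-- **HEADLINE — ANY NUMBER OF `(1,2)`-THREEFOLDS OVER PAIRWISE NON-ISOMORPHIC SEXTIC CM FIELDS AND OF `(2,3)`-FIVEFOLDS OVER PAIRWISE NON-ISOMORPHIC DECIC CM FIELDS, ALL
SHARING `k`, GIVEN ONLY MARKMAN'S FOURFOLD AND HYPERBOLIC-SIXFOLD THEOREMS.**  `k = Kf i₀` imaginary quadratic, `E = A 0 ⊨ (k; {τ})`, `B_m = A (m+1) ⊨ (K_m; Φ (m+1))` over CM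
fields `K_m ⊇ i_m(k)` with `([K_m : ℚ]/2, #(Φ (m+1) over τ)) ∈ {(3,1), (5,2)}` — simple CM threefolds over sextic fields, Weil-type CM fivefolds over decic fields, any number
of each in any order —, and NO ring homomorphism `K_m → K_{m₀}` whenever `m₀ ≠ m` have `n_{m₀} = n_m` (pairwise non-isomorphic sextics, pairwise non-isomorphic decics;
NOTHING is asked between a sextic and a decic field).  Then the Hodge conjecture holds for EVERY product of copies `E^a × ∏_m B_m^{b_m}`.  `HC_CM` is NOT asserted.  NOT
covered: non-isogenous factors over ISOMORPHIC fields; octic slots. [cite: Markman2025SurveySecant, Thm. 1.2] [cite: Markman2025SecantWeil, Thm 1.5.1] [cite: Pohlmann1968, Thm 1]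
[cite: MoonenZarhin1995Duke, Thm. 2.4] [cite: Dodson1984, §1.1 Imprimitivity Theorem and §5.1.2 Theorem] [cite: DixonMortimer1996, §3.3, Thm. 3.3A] [cite: Lang2002, I §5 Thm. 5.5] -/
theorem hodgeConjectureFor_biproduct_comp_of_sexticsDecics_of_isEmpty_ringHom (hW4 : Markman2025_weilClasses_algebraic_abelianFourfold)
    (hM6 : Markman2025_weilClasses_algebraic_hyperbolicSixfold) (n p : Fin r → ℕ) (hnp : ∀ m, (n m = 3 ∧ p m = 1) ∨ (n m = 5 ∧ p m = 2))
    {N : ℕ} (κ : Fin N → Fin (r + 1)) (h2 : Module.finrank ℚ (Kf i₀) = 2) (hdeg : ∀ m : Fin r, Module.finrank ℚ (Kf (is m)) = 2 * n m)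
    (im : ∀ m : Fin r, Kf i₀ →+* Kf (is m)) (hA : ∀ j, IsCMTypeRealisation (Φ j) (A j) (ι j) (θ j)) (hΨ : ∀ σ : Kf i₀ →+* ℂ, σ ∈ (Φ 0).1 ↔ σ = τ)
    (hp : ∀ m : Fin r, (Finset.univ.filter fun s : Kf (is m) →+* ℂ => s.comp (im m) = τ ∧ s ∈ (Φ m.succ).1).card = p m)
    (hiso : ∀ (m₀ m : Fin r), m₀ ≠ m → n m₀ = n m → IsEmpty (Kf (is m) →+* Kf (is m₀))) :
    HodgeConjectureFor (⨁ fun j => A (κ j)).dim (⨁ fun j => A (κ j)).X :=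
  hodgeConjectureFor_biproduct_comp_of_sexticsDecics_of_stabiliserTransitive hW4 hM6 n p hnp κ h2 hdeg im hA hΨ hp
    (stabiliserTransitive_of_sexticsDecics_of_isEmpty_ringHom h2 hdeg im (fun m => (hnp m).imp And.left And.left) hiso)

/-- **Dominated form**: every complex abelian variety dominated by such a product of copies satisfies the Hodge conjecture, given Markman's two theorems.
[cite: Markman2025SurveySecant, Thm. 1.2] [cite: Markman2025SecantWeil, Thm 1.5.1] [cite: MumfordAV1970, §19] -/
theorem hodgeConjectureFor_of_avDominatedBy_comp_of_sexticsDecics_of_isEmpty_ringHom (hW4 : Markman2025_weilClasses_algebraic_abelianFourfold)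
    (hM6 : Markman2025_weilClasses_algebraic_hyperbolicSixfold) (n p : Fin r → ℕ) (hnp : ∀ m, (n m = 3 ∧ p m = 1) ∨ (n m = 5 ∧ p m = 2))
    {N : ℕ} (κ : Fin N → Fin (r + 1)) (h2 : Module.finrank ℚ (Kf i₀) = 2) (hdeg : ∀ m : Fin r, Module.finrank ℚ (Kf (is m)) = 2 * n m)
    (im : ∀ m : Fin r, Kf i₀ →+* Kf (is m)) (hA : ∀ j, IsCMTypeRealisation (Φ j) (A j) (ι j) (θ j)) (hΨ : ∀ σ : Kf i₀ →+* ℂ, σ ∈ (Φ 0).1 ↔ σ = τ)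
    (hp : ∀ m : Fin r, (Finset.univ.filter fun s : Kf (is m) →+* ℂ => s.comp (im m) = τ ∧ s ∈ (Φ m.succ).1).card = p m)
    (hiso : ∀ (m₀ m : Fin r), m₀ ≠ m → n m₀ = n m → IsEmpty (Kf (is m) →+* Kf (is m₀)))
    {X : AbelianVariety ℂ} (hX : Domination.AVDominatedBy X (⨁ fun j => A (κ j))) : HodgeConjectureFor X.dim X.X :=
  Domination.hodgeConjectureFor_of_avDominatedBy
    (hodgeConjectureFor_biproduct_comp_of_sexticsDecics_of_isEmpty_ringHom hW4 hM6 n p hnp κ h2 hdeg im hA hΨ hp hiso) hX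

/-- **DEGREE FORM OF THE HYPOTHESIS** (no auxiliary `n`, `p`): degrees `[K_m : ℚ] ∈ {6, 10}` with `1` resp. `2` members of the type over `τ`, and `Hom(K_m, K_{m₀}) = ∅` for
`m₀ ≠ m` of EQUAL degree.  `HC_CM` is NOT asserted. [cite: Markman2025SurveySecant, Thm. 1.2] [cite: Markman2025SecantWeil, Thm 1.5.1] [cite: Dodson1984, §1.1 Imprimitivity Theorem]
[cite: DixonMortimer1996, §3.3, Thm. 3.3A] -/
theorem hodgeConjectureFor_biproduct_comp_of_sexticsDecics_of_isEmpty_ringHom_of_finrank (hW4 : Markman2025_weilClasses_algebraic_abelianFourfold)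
    (hM6 : Markman2025_weilClasses_algebraic_hyperbolicSixfold) {N : ℕ} (κ : Fin N → Fin (r + 1)) (h2 : Module.finrank ℚ (Kf i₀) = 2)
    (im : ∀ m : Fin r, Kf i₀ →+* Kf (is m)) (hA : ∀ j, IsCMTypeRealisation (Φ j) (A j) (ι j) (θ j)) (hΨ : ∀ σ : Kf i₀ →+* ℂ, σ ∈ (Φ 0).1 ↔ σ = τ)
    (h610 : ∀ m : Fin r, (Module.finrank ℚ (Kf (is m)) = 6 ∧ (Finset.univ.filter fun s : Kf (is m) →+* ℂ => s.comp (im m) = τ ∧ s ∈ (Φ m.succ).1).card = 1) ∨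
      (Module.finrank ℚ (Kf (is m)) = 10 ∧ (Finset.univ.filter fun s : Kf (is m) →+* ℂ => s.comp (im m) = τ ∧ s ∈ (Φ m.succ).1).card = 2))
    (hiso : ∀ (m₀ m : Fin r), m₀ ≠ m → Module.finrank ℚ (Kf (is m₀)) = Module.finrank ℚ (Kf (is m)) → IsEmpty (Kf (is m) →+* Kf (is m₀))) :
    HodgeConjectureFor (⨁ fun j => A (κ j)).dim (⨁ fun j => A (κ j)).X := by
  refine hodgeConjectureFor_biproduct_comp_of_sexticsDecics_of_isEmpty_ringHom hW4 hM6 (fun m => Module.finrank ℚ (Kf (is m)) / 2)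
    (fun m => (Finset.univ.filter fun s : Kf (is m) →+* ℂ => s.comp (im m) = τ ∧ s ∈ (Φ m.succ).1).card) (fun m => ?_) κ h2 (fun m => ?_) im hA hΨ
    (fun _ => rfl) fun m₀ m hm heq => hiso m₀ m hm ?_
  · rcases h610 m with ⟨h, h'⟩ | ⟨h, h'⟩ <;> rw [h, h'] <;> norm_num
  · rcases h610 m with ⟨h, -⟩ | ⟨h, -⟩ <;> rw [h]
  · have h₀ : Module.finrank ℚ (Kf (is m₀)) = 2 * (Module.finrank ℚ (Kf (is m₀)) / 2) := by rcases h610 m₀ with ⟨h, -⟩ | ⟨h, -⟩ <;> rw [h]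
    have h₁ : Module.finrank ℚ (Kf (is m)) = 2 * (Module.finrank ℚ (Kf (is m)) / 2) := by rcases h610 m with ⟨h, -⟩ | ⟨h, -⟩ <;> rw [h]
    rw [h₀, h₁, heq]

/-- **Dominated form of the degree form.** [cite: Markman2025SurveySecant, Thm. 1.2] [cite: Markman2025SecantWeil, Thm 1.5.1] [cite: MumfordAV1970, §19] -/
theorem hodgeConjectureFor_of_avDominatedBy_comp_of_sexticsDecics_of_isEmpty_ringHom_of_finrank (hW4 : Markman2025_weilClasses_algebraic_abelianFourfold)
    (hM6 : Markman2025_weilClasses_algebraic_hyperbolicSixfold) {N : ℕ} (κ : Fin N → Fin (r + 1)) (h2 : Module.finrank ℚ (Kf i₀) = 2)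
    (im : ∀ m : Fin r, Kf i₀ →+* Kf (is m)) (hA : ∀ j, IsCMTypeRealisation (Φ j) (A j) (ι j) (θ j)) (hΨ : ∀ σ : Kf i₀ →+* ℂ, σ ∈ (Φ 0).1 ↔ σ = τ)
    (h610 : ∀ m : Fin r, (Module.finrank ℚ (Kf (is m)) = 6 ∧ (Finset.univ.filter fun s : Kf (is m) →+* ℂ => s.comp (im m) = τ ∧ s ∈ (Φ m.succ).1).card = 1) ∨
      (Module.finrank ℚ (Kf (is m)) = 10 ∧ (Finset.univ.filter fun s : Kf (is m) →+* ℂ => s.comp (im m) = τ ∧ s ∈ (Φ m.succ).1).card = 2))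
    (hiso : ∀ (m₀ m : Fin r), m₀ ≠ m → Module.finrank ℚ (Kf (is m₀)) = Module.finrank ℚ (Kf (is m)) → IsEmpty (Kf (is m) →+* Kf (is m₀)))
    {X : AbelianVariety ℂ} (hX : Domination.AVDominatedBy X (⨁ fun j => A (κ j))) : HodgeConjectureFor X.dim X.X :=
  Domination.hodgeConjectureFor_of_avDominatedBy
    (hodgeConjectureFor_biproduct_comp_of_sexticsDecics_of_isEmpty_ringHom_of_finrank hW4 hM6 κ h2 im hA hΨ h610 hiso) hX

end Headline

end Summit.HodgeConjecture.CorCM.MultiFieldWeil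

end
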